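import Literature.AlgebraicGeometry.Motives.KunnethSections
import Literature.AlgebraicGeometry.Motives.PushforwardStructureSheaf
import Literature.AlgebraicGeometry.Morphisms.CechH1PullbackComp
import HarnessLib

/-!
# Čech classes on `pr_X⁻¹𝒱 ⊆ X ×_k Y` come from `X` when `Γ(Y, 𝒪_Y) = k`

Let `X`, `Y` be `k`-schemes with `Y` proper and geometrically integral (so that
`𝒪_X ⥲ pr_{X,*} 𝒪_{X ×_k Y}`, Görtz–Wedhorn II, Cor. 24.63; in this tree `isIso_app_snd` of
`Motives/PushforwardStructureSheaf`). Then for every family of opens `𝒱 = (V_a)` of `X` the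
pullback `pr_X^*` identifies the Čech cochains of `𝒪_X` on `𝒱` with those of `𝒪_{X ×_k Y}` on
`pr_X⁻¹𝒱 = (V_a ×_k Y)_a`; in particular

* `cechComapH1_fst_surjective` — every class in `Ȟ¹(pr_X⁻¹𝒱, 𝒪_{X ×_k Y})` is `pr_X^* α` for a
  class `α ∈ Ȟ¹(𝒱, 𝒪_X)`.

This is the "horizontal" half of the Künneth decomposition of `Ȟ¹` on product coverings
(`Motives/KunnethH1ProductCover`, Görtz–Wedhorn II, Cor. 22.110 / proof of Thm. 24.73). Also
recorded: `isIso_app_fst` (the `pr_X`-version of `isIso_app_snd`, by the symmetry of the fibre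
product), `comap_fst_bijective`, and the cochain-level composition of refinement maps
`cechRefineC1_refineC1`. Mathlib searched (pin): `pullbackSymmetry_hom_comp_snd`,
`Scheme.Hom.app_eq_appLE`, the instance `IsIso (f.app U)` for isomorphisms `f` (used).

## References

* U. Görtz, T. Wedhorn, *Algebraic Geometry II: Cohomology of Schemes*, Springer Spektrum (2023),
  doi:10.1007/978-3-658-43031-3: Cor. 24.63, p. 539; Cor. 22.110, p. 399; proof of Thm. 24.73,
  p. 550 (read via the held copy). [GortzWedhorn2023]
-/

universe u v w

open CategoryTheory CategoryTheory.Limits AlgebraicGeometry MonoidalCategory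
open CartesianMonoidalCategory
open Literature.AlgebraicGeometry.Morphisms

noncomputable section

namespace Literature.AlgebraicGeometry.Motives

variable {k : Type u} [Field k] (X Y : SchemeOver k)

/-! ### `pr_X^*` on sections is bijective -/

/-- **`𝒪_X ⥲ pr_{X,*}𝒪_{X ×_k Y}` for `Y` proper and geometrically integral** (Görtz–Wedhorn II,
Cor. 24.63; the tree's `isIso_app_snd` transported along the symmetry `X ×_k Y ≅ Y ×_k X`):
`Γ(U, 𝒪_X) → Γ(pr_X⁻¹U, 𝒪_{X ×_k Y})` is an isomorphism for every open `U ⊆ X`.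
[cite: GortzWedhorn2023, Cor. 24.63 (p. 539)] -/
theorem isIso_app_fst [IsProper Y.hom] [GeometricallyIntegral Y.hom] (U : X.left.Opens) :
    IsIso ((fst X Y).left.app U) := by
  have e : (fst X Y).left =
      (pullbackSymmetry X.hom Y.hom).hom ≫ pullback.snd Y.hom X.hom :=
    (pullbackSymmetry_hom_comp_snd X.hom Y.hom).symm
  have key : IsIso (((pullbackSymmetry X.hom Y.hom).hom ≫ pullback.snd Y.hom X.hom).app U) := by
    rw [Scheme.Hom.comp_app]
    have h1 : IsIso ((pullback.snd Y.hom X.hom).app U) := isIso_app_snd Y.hom X.hom U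
    have h2 : IsIso ((pullbackSymmetry X.hom Y.hom).hom.app ((pullback.snd Y.hom X.hom) ⁻¹ᵁ U)) :=
      inferInstance
    exact @IsIso.comp_isIso _ _ _ _ _ _ _ h1 h2
  rw [e]
  exact key

/-- Hence `pr_X^* : Γ(U, 𝒪_X) → Γ(pr_X⁻¹U, 𝒪_{X ×_k Y})` (`Sections.comap`) is bijective for every
open `U ⊆ X`. [cite: GortzWedhorn2023, Cor. 24.63 (p. 539)] -/
theorem comap_fst_bijective [IsProper Y.hom] [GeometricallyIntegral Y.hom] (U : X.left.Opens)
    (e : (fst X Y).left ⁻¹ᵁ U ≤ (fst X Y).left ⁻¹ᵁ U) :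
    Function.Bijective
      (Sections.comap X.hom (X ⊗ Y).hom (fst X Y).left (fst_left_comp_hom X Y) e) := by
  haveI := isIso_app_fst X Y U
  have h : (Sections.comap X.hom (X ⊗ Y).hom (fst X Y).left (fst_left_comp_hom X Y) e :
      Sections X.hom U → Sections (X ⊗ Y).hom ((fst X Y).left ⁻¹ᵁ U)) = (fst X Y).left.app U := by
    funext s
    rw [Sections.comap_apply, Scheme.Hom.app_eq_appLE]
  rw [h]
  exact ConcreteCategory.bijective_of_isIso _

/-! ### `Ȟ¹(pr_X⁻¹𝒱, 𝒪_{X ×_k Y}) = pr_X^* Ȟ¹(𝒱, 𝒪_X)` -/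

/-- **Every Čech class of `𝒪_{X ×_k Y}` on `pr_X⁻¹𝒱` is pulled back from `X`** when `Y` is proper
and geometrically integral: `pr_X^* : Ȟ¹(𝒱, 𝒪_X) → Ȟ¹(pr_X⁻¹𝒱, 𝒪_{X ×_k Y})` is surjective
(cochains correspond bijectively under `pr_X^*`, `comap_fst_bijective`, compatibly with `d¹`).
[cite: GortzWedhorn2023, Cor. 22.110 (p. 399) and Cor. 24.63 (p. 539)] -/
theorem cechComapH1_fst_surjective [IsProper Y.hom] [GeometricallyIntegral Y.hom] {A : Type v}
    (V : A → X.left.Opens) :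
    Function.Surjective
      (cechComapH1 X.hom (X ⊗ Y).hom (fst X Y).left (fst_left_comp_hom X Y) V) := by
  intro x
  obtain ⟨y, rfl⟩ := CechH1.mk_surjective _ _ x
  -- invert `pr_X^*` componentwise
  have hbij := fun a a' => comap_fst_bijective X Y (V a ⊓ V a') (fun _ hx => hx)
  let α : CechC1 X.hom V := fun a a' => Function.surjInv (hbij a a').2
    (show Sections (X ⊗ Y).hom ((fst X Y).left ⁻¹ᵁ (V a ⊓ V a')) from
      (y : CechC1 (X ⊗ Y).hom (preimageFamily (fst X Y).left V)) a a')
  have hα : cechComapC1 X.hom (X ⊗ Y).hom (fst X Y).left (fst_left_comp_hom X Y) V α = y := by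
    funext a a'
    exact Function.surjInv_eq (hbij a a').2 _
  -- `α` is a cocycle: `pr_X^*(d¹ α) = d¹(pr_X^* α) = d¹ y = 0` and `pr_X^*` is injective
  have hαZ : α ∈ cechZ1 X.hom V := by
    rw [mem_cechZ1_iff]
    have h := cechD1_comapC1 X.hom (X ⊗ Y).hom (fst X Y).left (fst_left_comp_hom X Y) V α
    rw [hα, (mem_cechZ1_iff _ _ _).mp y.2] at h
    funext a a' a''
    have h3 := congrFun (congrFun (congrFun h a) a') a''
    rw [cechComapC2_apply, Pi.zero_apply, Pi.zero_apply, Pi.zero_apply] at h3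
    change cechD1 X.hom V α a a' a'' = 0
    apply (comap_fst_bijective X Y (V a ⊓ V a' ⊓ V a'') (fun _ hx => hx)).1
    rw [map_zero]
    exact h3.symm
  refine ⟨CechH1.mk X.hom V ⟨α, hαZ⟩, ?_⟩
  rw [cechComapH1_mk]
  congr 1
  exact Subtype.ext hα

/-! ### Composition of refinements on cochains -/

/-- Refinement maps compose on `1`-cochains: `ρ_σ (ρ_τ c) = ρ_{τ ∘ σ} c`. [folklore] -/
theorem cechRefineC1_refineC1 {Z : Scheme.{u}} (f : Z ⟶ Spec (.of k)) {ι : Type v} {ι' : Type w}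
    {ι'' : Type*} (U : ι → Z.Opens) (V : ι' → Z.Opens) (W : ι'' → Z.Opens) (τ : ι' → ι)
    (hτ : ∀ j, V j ≤ U (τ j)) (σ : ι'' → ι') (hσ : ∀ l, W l ≤ V (σ l)) (c : CechC1 f U) :
    cechRefineC1 f V W σ hσ (cechRefineC1 f U V τ hτ c) =
      cechRefineC1 f U W (τ ∘ σ) (fun l => (hσ l).trans (hτ (σ l))) c := by
  funext l l'
  simp only [cechRefineC1_apply, Sections.res_res]
  rfl

end Literature.AlgebraicGeometry.Motives

end
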